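import Mathlib
import Literature.Barriers.ValiantsHypothesis.AlgebraicNaturalProofs
import Literature.Computability.AlgebraicComplexity.ApolarityAction
import HarnessLib

/-!
# Crux `BarrierLever.SuccinctHittingSetsForVP` (stmt-ValiantsHypothesis-14610), line `registered` —
stub `stub_sigmaLambdaSigma`: `ΣΛΣ` CIRCUITS HAVE FEW PARTIAL DERIVATIVES

**What is proved (unconditional; a worker-sized stub of wave 3, it does NOT close the item).**
For a sum of `s` powers of affine forms in the variables `X_μ`, `μ ∈ A` (a `ΣΛΣ`, i.e. diagonal
depth-3, circuit)
`D = Σ_i c_i L_i^{d_i}`, `L_i = a₀ᵢ + Σ_{μ ∈ A} a_{iμ} X_μ`,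
there is a subspace `V ≤ ℂ[X]` of dimension `≤ Σ_i (d_i + 1)` containing `g ⌟ D` for EVERY
constant-coefficient differential operator `g` (`apolarAction g D`, the apolarity action of
`Literature.Computability.AlgebraicComplexity`): all iterated partial derivatives of `D` span a
low-dimensional space.

* `stub_sigmaLambdaSigma` : the statement registered in the skeleton
  (`Cruxes/SuccinctHittingSetsForVP/Lines/birth.lean`, STUB C).

**Proof (the classical partial-derivative method for diagonal circuits).** Take
`V := span {L_i^j : i < s, j ≤ d_i}`, the span of a family indexed by the finite type
`Σ i : Fin s, Fin (d_i + 1)`, so `dim V ≤ Σ_i (d_i + 1)` (`finrank_range_le_card`). Since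
`∂_μ L_i = C b` is a constant, `∂_μ L_i^j = (j b) • L_i^{j-1} ∈ V` (`pderiv_pow`), so `V` is stable
under every first partial `∂_μ = X_μ ⌟ ·` (`apolarAction_X`), hence — by induction on the operator,
using `C b ⌟ v = b • v`, additivity and `(p X_μ) ⌟ v = p ⌟ (X_μ ⌟ v)` (`apolarAction_C`,
`apolarAction_add_left`, `apolarAction_mul`) — under every operator `g`; and `D ∈ V`.
Axioms: `propext`, `Classical.choice`, `Quot.sound`.

References: the partial-derivative method of N. Nisan, A. Wigderson, *Lower bounds on arithmetic
circuits via partial derivatives*, Comput. Complexity 6 (1996) [NisanWigderson1996];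
[ForbesShpilkaVolk2018] Question 6 (the crux).
-/

-- layout Summits/ValiantsHypothesis/ValiantsHypothesis forces the duplicated namespace component
set_option linter.dupNamespace false

namespace Summit.ValiantsHypothesis.ValiantsHypothesis.Theorems.BarrierLever.SuccinctHittingSetsForVP

open Literature.Barriers.ValiantsHypothesis Literature.Computability.AlgebraicComplexity MvPolynomial

namespace SigmaLambdaSigma

variable {ι : Type}

/-- A subspace of `ℂ[X]` stable under every first partial derivative `∂_μ` is stable under every
constant-coefficient differential operator `g ⌟ ·` (induction on `g`: constants act as scalars,
additivity, and `(p · X_μ) ⌟ v = p ⌟ (∂_μ v)`). [folklore] -/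
theorem apolarAction_mem_of_pderiv_mem (V : Submodule ℂ (MvPolynomial ι ℂ))
    (hV : ∀ μ : ι, ∀ v ∈ V, pderiv μ v ∈ V) (g : MvPolynomial ι ℂ) :
    ∀ v ∈ V, apolarAction g v ∈ V := by
  induction g using MvPolynomial.induction_on with
  | C b =>
    intro v hv
    rw [apolarAction_C]
    exact V.smul_mem b hv
  | add p q hp hq =>
    intro v hv
    rw [apolarAction_add_left]
    exact V.add_mem (hp v hv) (hq v hv)
  | mul_X p μ hp =>
    intro v hv
    rw [apolarAction_mul, apolarAction_X]
    exact hp _ (hV μ v hv)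

/-- If every generator of a span has its `μ`-th partial inside the span, the span is stable under
`∂_μ` (linearity of `∂_μ`). [folklore] -/
theorem pderiv_mem_span_of_generators (G : Set (MvPolynomial ι ℂ)) (μ : ι)
    (hG : ∀ x ∈ G, pderiv μ x ∈ Submodule.span ℂ G) :
    ∀ v ∈ Submodule.span ℂ G, pderiv μ v ∈ Submodule.span ℂ G := by
  intro v hv
  induction hv using Submodule.span_induction with
  | mem x hx => exact hG x hx
  | zero =>
    rw [map_zero]
    exact Submodule.zero_mem _
  | add x y _ _ hx hy =>
    rw [map_add]
    exact Submodule.add_mem _ hx hy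
  | smul b x _ hx =>
    rw [Derivation.map_smul]
    exact Submodule.smul_mem _ b hx

/-- The partial derivatives of an affine form `b₀ + Σ_{ν ∈ A} b_ν X_ν` are constants
(`∂_μ` of it is `b_μ` if `μ ∈ A`, else `0`). [folklore] -/
theorem exists_pderiv_affineForm_eq_C (A : Finset ι) (b₀ : ℂ) (b : ι → ℂ) (μ : ι) :
    ∃ e : ℂ, pderiv μ (C b₀ + ∑ ν ∈ A, C (b ν) * X ν : MvPolynomial ι ℂ) = C e := by
  classical
  refine ⟨if μ ∈ A then b μ else 0, ?_⟩
  rw [map_add, pderiv_C, zero_add, map_sum]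
  have h : ∀ ν ∈ A, pderiv μ (C (b ν) * X ν : MvPolynomial ι ℂ) =
      if ν = μ then C (b ν) else 0 := by
    intro ν _
    rw [pderiv_C_mul, pderiv_X, Pi.single_apply, mul_ite, mul_one, mul_zero]
  rw [Finset.sum_congr rfl h, Finset.sum_ite_eq', apply_ite C, C_0]

/-- `∂_μ L^j = (j e) • L^{j-1}` when `∂_μ L = C e` is a constant. [folklore] -/
theorem pderiv_pow_of_pderiv_eq_C {L : MvPolynomial ι ℂ} {μ : ι} {e : ℂ}
    (h : pderiv μ L = C e) (j : ℕ) :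
    pderiv μ (L ^ j) = ((j : ℂ) * e) • L ^ (j - 1) := by
  rw [pderiv_pow, h, smul_eq_C_mul, map_mul, map_natCast]
  ring

/-- For a family `L_i` with constant first partials, every `∂_μ (L_i^j)`, `j ≤ d_i`, lies in
`span {L_i^j : i < s, j ≤ d_i}` (it is a multiple of `L_i^{j-1}`). [folklore] -/
theorem pderiv_generator_mem {s : ℕ} (L : Fin s → MvPolynomial ι ℂ) (d : Fin s → ℕ)
    (hL : ∀ (i : Fin s) (μ : ι), ∃ e : ℂ, pderiv μ (L i) = C e) (μ : ι)
    (k : Σ i : Fin s, Fin (d i + 1)) :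
    pderiv μ (L k.1 ^ (k.2 : ℕ)) ∈
      Submodule.span ℂ (Set.range fun k : Σ i : Fin s, Fin (d i + 1) => L k.1 ^ (k.2 : ℕ)) := by
  obtain ⟨i, j⟩ := k
  obtain ⟨e, he⟩ := hL i μ
  rw [pderiv_pow_of_pderiv_eq_C he]
  exact Submodule.smul_mem _ _
    (Submodule.subset_span ⟨⟨i, ⟨(j : ℕ) - 1, (Nat.sub_le _ _).trans_lt j.isLt⟩⟩, rfl⟩)

/-- **The partial-derivative space of a `ΣΛΣ` circuit**, abstract form: if the `L_i` have constant
first partials, then `V := span {L_i^j : i < s, j ≤ d_i}` is finite-dimensional of dimension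
`≤ Σ_i (d_i + 1)` and contains `g ⌟ (Σ_i c_i L_i^{d_i})` for every operator `g`. [folklore] -/
theorem exists_submodule {s : ℕ} (L : Fin s → MvPolynomial ι ℂ) (d : Fin s → ℕ) (c : Fin s → ℂ)
    (hL : ∀ (i : Fin s) (μ : ι), ∃ e : ℂ, pderiv μ (L i) = C e) :
    ∃ V : Submodule ℂ (MvPolynomial ι ℂ), FiniteDimensional ℂ V ∧
      Module.finrank ℂ V ≤ ∑ i, (d i + 1) ∧
      ∀ g : MvPolynomial ι ℂ, apolarAction g (∑ i : Fin s, C (c i) * L i ^ (d i)) ∈ V := by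
  refine ⟨Submodule.span ℂ (Set.range fun k : Σ i : Fin s, Fin (d i + 1) => L k.1 ^ (k.2 : ℕ)),
    FiniteDimensional.span_of_finite ℂ (Set.finite_range _), ?_, ?_⟩
  · calc Module.finrank ℂ
          (Submodule.span ℂ (Set.range fun k : Σ i : Fin s, Fin (d i + 1) => L k.1 ^ (k.2 : ℕ)))
        ≤ Fintype.card (Σ i : Fin s, Fin (d i + 1)) := finrank_range_le_card (R := ℂ) _
      _ = ∑ i, (d i + 1) := by simp only [Fintype.card_sigma, Fintype.card_fin]
  · have hX : ∀ μ : ι, ∀ v ∈ Submodule.span ℂ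
        (Set.range fun k : Σ i : Fin s, Fin (d i + 1) => L k.1 ^ (k.2 : ℕ)),
        pderiv μ v ∈
          Submodule.span ℂ (Set.range fun k : Σ i : Fin s, Fin (d i + 1) => L k.1 ^ (k.2 : ℕ)) := by
      intro μ
      refine pderiv_mem_span_of_generators _ μ ?_
      rintro x ⟨k, rfl⟩
      exact pderiv_generator_mem L d hL μ k
    have hD : (∑ i : Fin s, C (c i) * L i ^ (d i)) ∈
        Submodule.span ℂ (Set.range fun k : Σ i : Fin s, Fin (d i + 1) => L k.1 ^ (k.2 : ℕ)) := by
      refine Submodule.sum_mem _ fun i _ => ?_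
      rw [← smul_eq_C_mul]
      exact Submodule.smul_mem _ _ (Submodule.subset_span ⟨⟨i, ⟨d i, lt_add_one _⟩⟩, rfl⟩)
    intro g
    exact apolarAction_mem_of_pderiv_mem _ hX g _ hD

end SigmaLambdaSigma

open SigmaLambdaSigma

/-- **Registered stub `stub_sigmaLambdaSigma`** (crux stmt-ValiantsHypothesis-14610, line
`registered`; `ΣΛΣ` has low partials): a sum of `s` powers of affine forms
`D = Σ_i c_i (a₀ᵢ + Σ_{μ ∈ A} a_{iμ} X_μ)^{d_i}` has all its partial derivatives `g ⌟ D` inside a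
subspace of dimension `≤ Σ_i (d_i + 1)` (the span of the powers `L_i^j`, `j ≤ d_i`) — the classical
partial-derivative bound for diagonal depth-3 circuits. [folklore] -/
theorem stub_sigmaLambdaSigma :
    ∀ (ι : Type) (s : ℕ) (A : Finset ι) (c a₀ : Fin s → ℂ) (a : Fin s → ι → ℂ) (d : Fin s → ℕ),
      ∃ V : Submodule ℂ (MvPolynomial ι ℂ), FiniteDimensional ℂ V ∧
        Module.finrank ℂ V ≤ ∑ i, (d i + 1) ∧
        ∀ g : MvPolynomial ι ℂ, apolarAction g
          (∑ i : Fin s, C (c i) * (C (a₀ i) + ∑ μ ∈ A, C (a i μ) * X μ) ^ (d i)) ∈ V := by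
  intro ι s A c a₀ a d
  exact exists_submodule (fun i => C (a₀ i) + ∑ μ ∈ A, C (a i μ) * X μ) d c
    fun i μ => exists_pderiv_affineForm_eq_C A (a₀ i) (a i) μ

end Summit.ValiantsHypothesis.ValiantsHypothesis.Theorems.BarrierLever.SuccinctHittingSetsForVP
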